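import Summits.PneNP.PneNP.Theses.PhaseTwins
import Literature.Computability.Complexity.ClockedUniversalAcceptance
import Literature.Computability.Complexity.HardcoreInapproximability
import Literature.Computability.Cryptography.SparseLPN

/-!
# Sketch — crux-ideate stmt-PneNP-2721 (PseudorandomTwinsAbove), ideator 3, round 1

First lemmas of the three idea cards (signatures only; `sorry` bodies). Namespaced away from the
route. Cards: `length-advice-horizon` (A), `alekhnovich-gadget-twins` (B),
`subks-planted-independent-sets` (C).
-/

namespace Summit.PneNP.PneNP.Cruxes.PseudorandomTwinsAbove.Ideator3

open Filter
open Literature.Computability.Complexity Literature.Computability.MetaComplexity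
open Literature.Probability.LatticeModels Computability

/-- Clause (i) of the crux, verbatim, as a predicate on a pair of ensembles: INDEX-FREE tests
(the distinguisher sees the sample `x` only; its coin budget `coinLen |x|` is an arbitrary
polynomially bounded function of the sample length — an `O(log |x|)`-bit length-advice channel). -/
def IndexFreeIndist (D₀ D₁ : Ensemble) : Prop :=
  ∀ A : RandAlg (List Bool) Bool, A.IsPolyTime (id : List Bool → List Bool) encodeBool →
    Tendsto (fun n : ℕ => |(∑' x : List Bool, ((D₀ n) x).toReal * A.pr id x {b | b = true}) -
      (∑' x : List Bool, ((D₁ n) x).toReal * A.pr id x {b | b = true})|) atTop (nhds 0)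

/-- Clause (ii) of the crux for an abstract count `N` and threshold sequence `t`. -/
def CountSeparated (D₀ D₁ : Ensemble) (N : List Bool → ℕ) (t : ℕ → ℕ) : Prop :=
  Tendsto (fun n : ℕ => D₀.prob n {x | 8 * t n ≤ N x}) atTop (nhds 1) ∧
    Tendsto (fun n : ℕ => D₁.prob n {x | 0 < N x ∧ N x ≤ t n}) atTop (nhds 1)

/-! ## Card A — `length-advice-horizon` -/

/-- A.1 (length escape). Under (i)+(ii) the mass of every bounded set of lengths vanishes:
lookup-table tests on `{0,1}^{≤ℓ₀}` are polynomial time, and (ii) makes the conditional laws on a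
fixed finite set asymptotically disjointly supported. Holds for EVERY `N`. -/
theorem lengthEscape (D₀ D₁ : Ensemble) (N : List Bool → ℕ) (t : ℕ → ℕ)
    (hi : IndexFreeIndist D₀ D₁) (hii : CountSeparated D₀ D₁ N t) (ℓ₀ : ℕ) :
    Tendsto (fun n : ℕ => D₀.prob n {x | x.length ≤ ℓ₀}) atTop (nhds 0) ∧
      Tendsto (fun n : ℕ => D₁.prob n {x | x.length ≤ ℓ₀}) atTop (nhds 0) := by
  sorry

/-- A.2 (the coin-length advice test). For a transducer `F ∈ FP`, polynomials `c r` and ANY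
polynomially bounded `adv : ℕ → ℕ` (not necessarily computable) there is a PPT index-free test
whose acceptance probability on `x` is the probability, over the `c(|x|+r|x|+101)` coins of `F`,
that the estimate at accuracy `kη = 1`, confidence `kδ = 100` is at least `2^{adv |x|}`: the test
reads `adv |x|` off the LENGTH of its own coin string (`coinLen ℓ := c(…) + adv ℓ`). -/
theorem adviceThresholdTest (F : List Bool → List Bool) (hF : F ∈ FP) (c r : Polynomial ℕ)
    (adv : ℕ → ℕ) (hadv : ∃ d : Polynomial ℕ, ∀ ℓ, adv ℓ ≤ d.eval ℓ) :
    ∃ A : RandAlg (List Bool) Bool, A.IsPolyTime (id : List Bool → List Bool) encodeBool ∧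
      ∀ x : List Bool, A.pr id x {b | b = true} =
        uniformProb (c.eval (x.length + r.eval x.length + 1 + 100))
          {u | 2 ^ adv x.length ≤ countEstimate F x (r.eval x.length) 1 100 u} := by
  sorry

/-- A.3 = item stmt-PneNP-2723 (`PseudorandomTwinsImplyTarget`), NEW proof route: from `¬X` take
the factor-2 FBPP approximator; by A.1 choose indices `n₁ < n₂ < …` with pairwise disjoint
99%-length-blocks; put the octave of `3·t(n_j)` into `adv` on the `j`-th block; A.2 gives a test
with advantage `≥ 0.9` along `n_j`, contradicting (i). -/
theorem glue_by_length_advice :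
    Summit.PneNP.PneNP.Theses.PhaseTwins.PseudorandomTwinsAbove →
      Summit.PneNP.PneNP.Theses.PhaseTwins.NoFBPPApproxAboveUniqueness := by
  sorry

/-- The worst-case hypothesis of the horizon direction: every ADVISED PPT `B` (advice `adv ℓ` of
polynomial length, fed as `boolPair (adv ℓ) x`) fails, for every margin `1/j`, at infinitely many
lengths `ℓ`, to separate `{N ≥ 8 t⋆ ℓ}` from `{0 < N ≤ t⋆ ℓ}` among length-`ℓ` instances. For
`N = hardcoreCount Δ p q` above `λ_c` and the GŠV threshold schedule `t⋆` this follows from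
`SAT ∉ P/poly` (GŠV16 Thm 1 as a randomized gap reduction, Adleman, padding). -/
def AdvisedSeparationFails (N : List Bool → ℕ) (tstar : ℕ → ℕ) : Prop :=
  ∀ (B : RandAlg (List Bool) Bool) (adv : ℕ → List Bool),
    B.IsPolyTime (id : List Bool → List Bool) encodeBool →
    (∃ d : Polynomial ℕ, ∀ ℓ, (adv ℓ).length ≤ d.eval ℓ) →
    ∀ j ℓ₀ : ℕ, 0 < j → ∃ ℓ : ℕ, ℓ₀ ≤ ℓ ∧ ∃ x y : List Bool, x.length = ℓ ∧ y.length = ℓ ∧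
      8 * tstar ℓ ≤ N x ∧ 0 < N y ∧ N y ≤ tstar ℓ ∧
      B.pr id (boolPair (adv ℓ) x) {b | b = true} ≤
        B.pr id (boolPair (adv ℓ) y) {b | b = true} + 1 / (j : ℝ)

/-- A.4 (horizon twins). From the clocked universal machine (named fact) and the worst-case
hypothesis, the crux AS TYPED follows: a deterministic-search sampler working at lengths
`ℓ ≪ log log n` finds, by finite minimax + sparsification, pairs of sparse distributions on
YES/NO instances fooling every (code, coin-length) candidate of level `j(n) → ∞` within `2/j(n)`. -/
theorem horizonTwins (hU : clockedUniversalAcceptance) {Δ p q : ℕ} (hΔ : 3 ≤ Δ) (hq : 0 < q)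
    (hlam : hardCoreThreshold Δ < (p : ℝ) / q) (tstar : ℕ → ℕ)
    (hH : AdvisedSeparationFails (hardcoreCount Δ p q) tstar) :
    Summit.PneNP.PneNP.Theses.PhaseTwins.PseudorandomTwinsAbove := by
  sorry

/-- A.5 (diagnostic pigeonhole: why only the coin-length advice keeps the typed crux non-trivial).
`s` profiles with values in `[0,1]` on `K > (⌈4/ε⌉+1)^s` points spaced by 3 must nearly coincide on
two of them: with a COMPUTABLE coin budget the empty graphs `G_{3a}, G_{3b}` would already be
twins. -/
theorem profilePigeonhole (s : ℕ) (ε : ℝ) (hε : 0 < ε) (f : Fin s → ℕ → ℝ)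
    (hf : ∀ i k, f i k ∈ Set.Icc (0 : ℝ) 1) (K : ℕ) (hK : (Nat.ceil (4 / ε) + 1) ^ s < K) :
    ∃ a b : ℕ, a < b ∧ b ≤ K ∧ ∀ i, |f i (3 * a) - f i (3 * b)| ≤ ε := by
  sorry

/-! ## Card B — `alekhnovich-gadget-twins` -/

/-- Push an ensemble through a randomized polynomial-time map `R` (fresh coins per sample). -/
noncomputable def mapEnsemble (R : RandAlg (List Bool) (List Bool)) (D : Ensemble) : Ensemble :=
  fun n => (D n).bind fun x => R.outputPMF (id : List Bool → List Bool) x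

/-- B.1 (transport). Index-free indistinguishability is preserved by every LENGTH-REGULAR PPT map
(output length a function of input length — needed because the composed test's coin budget must be
a function of the sample length alone). -/
theorem transport_indexFree (R : RandAlg (List Bool) (List Bool))
    (hR : R.IsPolyTime (id : List Bool → List Bool) (id : List Bool → List Bool))
    (hlen : ∃ g : ℕ → ℕ, ∀ x r, (R.run x r).length = g x.length)
    (D₀ D₁ : Ensemble) (h : IndexFreeIndist D₀ D₁) :
    IndexFreeIndist (mapEnsemble R D₀) (mapEnsemble R D₁) := by
  sorry

/-- B.2 (samplability is preserved). -/
theorem isPolySamplable_map (R : RandAlg (List Bool) (List Bool))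
    (hR : R.IsPolyTime (id : List Bool → List Bool) (id : List Bool → List Bool))
    (D : Ensemble) (hD : D.IsPolySamplable) : (mapEnsemble R D).IsPolySamplable := by
  sorry

/-- B.3 (index-fed ⇒ index-free for fixed-length ensembles). Goldreich-style indistinguishability
(tree `IsCompIndistinguishable`, negligible advantage, distinguisher fed `1ⁿ`) implies clause (i)
whenever all samples at index `n` have one length `ℓ n` with `ℓ` injective (true for the sparse-LPN
ensembles: `length_encodeLPN`). -/
theorem indexFree_of_isCompIndistinguishable (X Y : Ensemble) (ℓ : ℕ → ℕ) (hℓ : Function.Injective ℓ)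
    (hX : ∀ n, ∀ x ∈ (X n).support, x.length = ℓ n) (hY : ∀ n, ∀ y ∈ (Y n).support, y.length = ℓ n)
    (h : Literature.Computability.Cryptography.IsCompIndistinguishable X Y) :
    IndexFreeIndist X Y := by
  sorry

/-- B.4 (assembly of the card). Abstract form: two samplable, index-free-indistinguishable source
ensembles (dyadic sparse-LPN planted / null under `AlekhnovichHypothesis`) and a length-regular PPT
gadget chain `R` (3LIN → MAX-CUT → Sly/GŠV phase gadgets) transporting them to a factor-8 gap of
`hardcoreCount Δ p q` give the crux. -/
theorem gadgetTwins (P Q : Ensemble) (hP : P.IsPolySamplable) (hQ : Q.IsPolySamplable)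
    (hind : IndexFreeIndist P Q) (R : RandAlg (List Bool) (List Bool))
    (hR : R.IsPolyTime (id : List Bool → List Bool) (id : List Bool → List Bool))
    (hlen : ∃ g : ℕ → ℕ, ∀ x r, (R.run x r).length = g x.length)
    {Δ p q : ℕ} (hΔ : 3 ≤ Δ) (hq : 0 < q) (hlam : hardCoreThreshold Δ < (p : ℝ) / q)
    (t : ℕ → ℕ) (hgap : CountSeparated (mapEnsemble R P) (mapEnsemble R Q) (hardcoreCount Δ p q) t) :
    Summit.PneNP.PneNP.Theses.PhaseTwins.PseudorandomTwinsAbove := by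
  sorry

/-- The source hypothesis of card B in tree vocabulary (a `Prop` definition of the tree; nothing is
asserted): sparse-LPN / noisy-3XOR indistinguishability at density `Δ'`, noise `η`. -/
example (Δ' η : ℝ) : Prop := Literature.Computability.Cryptography.AlekhnovichHypothesis Δ' η

/-! ## Card C — `subks-planted-independent-sets` -/

/-- The annealed (first-moment) exponent of independent sets of density `a` in random `Δ`-regular
graphs (configuration model): `(1/n) log E[#IS of size an] → H(a) + Δ((1-a)log(1-a) − ½(1-2a)log(1-2a))`. -/
noncomputable def isFirstMomentExponent (Δ : ℕ) (a : ℝ) : ℝ :=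
  -(a * Real.log a) - (1 - a) * Real.log (1 - a) +
    Δ * ((1 - a) * Real.log (1 - a) - (1 - 2 * a) * Real.log (1 - 2 * a) / 2)

/-- C.1 (the planting window at `Δ = 100`). Independent sets of density `0.07` are annealed-absent
(`exponent < 0`, so `α(G)/n < 0.07` w.h.p. in the null model) while a degree-balanced planted
independent set of density `0.08` sits BELOW the Kesten–Stigum bound `β/(1-β) < 1/√(Δ-1)` of the
asymmetric-Ising reconstruction problem it induces. -/
theorem plantingWindow_100 :
    isFirstMomentExponent 100 (7 / 100) < 0 ∧ (8 / 100 : ℝ) / (1 - 8 / 100) < 1 / Real.sqrt 99 := by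
  sorry

/-- C.2 (assembly of the card, abstract form): girth-conditioned null `Q` / planted `P` ensembles of
`100`-regular graphs, samplable, index-free indistinguishable (the sub-KS hard-phase hypothesis), and
count-separated at `(Δ, p, q) = (100, 2^101, 1)` with `t n = 2^n · (2^101)^⌈0.07 n⌉`, give the crux. -/
theorem plantedISTwins (P Q : Ensemble) (hP : P.IsPolySamplable) (hQ : Q.IsPolySamplable)
    (hind : IndexFreeIndist P Q)
    (hsep : CountSeparated P Q (hardcoreCount 100 (2 ^ 101) 1)
      (fun n => 2 ^ n * (2 ^ 101) ^ Nat.ceil ((7 : ℝ) / 100 * n))) :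
    Summit.PneNP.PneNP.Theses.PhaseTwins.PseudorandomTwinsAbove := by
  sorry

end Summit.PneNP.PneNP.Cruxes.PseudorandomTwinsAbove.Ideator3
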